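import Summits.KontsevichZagierPeriods.KontsevichZagierPeriods.Theorems.FermatIsogenyBetaProductSectorStubQuadStep
import Summits.KontsevichZagierPeriods.KontsevichZagierPeriods.Theorems.FermatIsogenyBetaProductSectorStubDdStepChartsP
import Literature.NumberTheory.Transcendental.KZProductIdeal

/-!
# `BetaProductSector` (stmt-KontsevichZagierPeriods-3898), line `registered` (v3) — stub `stub_ddStep`,
# part 4: the left chain of the two-duplication move DD

Fourth part of the two-duplication move DD `B(c+½-d, 2c+2d)·B(c,d) = 4^d·B(2c, c+d+½)·B(c+½-d, d)`. The unweighted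
LEFT box `U = [(0,1)², x^{c-½-d}(1-x)^{2c+2d-1} y^{c-1}(1-y)^{d-1}]` (value `B(c+½-d, 2c+2d)·B(c,d)`) is carried onto
the parameter surface `P = {(w,v) | 0 < w, w(1+w) < v(1-v)}` by four moves of the Kontsevich–Zagier calculus
(rules (2) of Kontsevich–Zagier 2001 §1.2 only):

1. the Kummer covering `y = η²` (`KZ.IsMellinMemberWith.of_sub_of_mem_relations_dilate`);
2. the coordinate swap and the linear Dirichlet chart `(t,u) ↦ (u,(1-u)t)` onto the simplex
   `S = [{x>0,σ>0,x+σ<1}, 2x^{c-½-d}(1-x)σ^{2c-1}((1-x)²-σ²)^{d-1}]` (`KZ.exists_dirichletLinearChart`);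
3. the chart `χ(x,σ) = (σ,xσ)` onto the lens `T = [{0<g<σ(1-σ)}, 2(gσ)^{c-½-d}(σ-g)((σ-g)²-σ⁴)^{d-1}]`
   (`DdStep.exists_chartChi`);
4. the chart `(w,v) ↦ (σ,g) = (1+w-v, v(1-v)-w(1+w))` of `T` by `P` (`DdStep.exists_chartPT`), giving
   `L = [P, 4·F^{c-½-d}·X^{d-1}·D·(v+w)]` with `F = σg`, `X = 4wv((1-v)²+w(2+w-v))`, `D = w²+2w+(1-v)²`
   (`DdStep.left_chain`).

All intermediate representations are constructed here (Euler–Mellin integrands, integrability transported by Mathlib's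
Jacobian criterion). Everything is proved; no `def`, no named fact.
-/

noncomputable section

open MeasureTheory Set
open Literature.ModelTheory.ExponentialFields (IsSemialgebraic)
open MvPolynomial (aeval X C)

namespace Summit.KontsevichZagierPeriods.FermatIsogeny.BetaProductSectorStubs

open Literature.NumberTheory.Transcendental
open Literature.NumberTheory.Transcendental.KZ

namespace DdStep

/-! ## The Euler–Mellin integrands of the simplex, the lens and the parameter surface, unfolded -/

/-- The simplex integrand `2 x^{c-½-d} (1-x) σ^{2c-1} ((1-x)²-σ²)^{d-1}`, unfolded. [folklore] -/
theorem mellin_simplexL_apply (c d : ℚ) (z : Fin 2 → ℝ) :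
    KZ.mellinIntegrand (![X 0, 1 - X 0, X 1, (1 - X 0) ^ 2 - X 1 ^ 2] : Fin 4 → MvPolynomial (Fin 2) ℚ)
        ![c - 1 / 2 - d, 1, 2 * c - 1, d - 1] 2 z =
      2 * ((z 0) ^ ((c:ℝ) - 1 / 2 - d) * (1 - z 0) * (z 1) ^ (2 * (c:ℝ) - 1) *
        ((1 - z 0) ^ 2 - (z 1) ^ 2) ^ ((d:ℝ) - 1)) := by
  rw [KZ.mellinIntegrand_apply, Fin.prod_univ_four]
  simp only [Matrix.cons_val_zero, Matrix.cons_val_one, Matrix.cons_val, map_sub, map_pow, map_one,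
    MvPolynomial.aeval_X]
  push_cast
  rw [Real.rpow_one]

/-- The lens integrand `2 (gσ)^{c-½-d} (σ-g) ((σ-g)²-σ⁴)^{d-1}`, unfolded. [folklore] -/
theorem mellin_lens_apply (c d : ℚ) (y : Fin 2 → ℝ) :
    KZ.mellinIntegrand (![X 1 * X 0, X 0 - X 1, (X 0 - X 1) ^ 2 - X 0 ^ 4] : Fin 3 → MvPolynomial (Fin 2) ℚ)
        ![c - 1 / 2 - d, 1, d - 1] 2 y =
      2 * ((y 1 * y 0) ^ ((c:ℝ) - 1 / 2 - d) * (y 0 - y 1) * ((y 0 - y 1) ^ 2 - (y 0) ^ 4) ^ ((d:ℝ) - 1)) := by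
  rw [KZ.mellinIntegrand_apply, Fin.prod_univ_three]
  simp only [Matrix.cons_val_zero, Matrix.cons_val_one, Matrix.cons_val, map_sub, map_mul, map_pow,
    MvPolynomial.aeval_X]
  push_cast
  rw [Real.rpow_one]

/-- The left integrand `4 F^{c-½-d} X^{d-1} D (v+w)` of the parameter surface, unfolded (`F = (1+w-v)(v(1-v)-w(1+w))`,
`X = 4wv((1-v)²+w(2+w-v))`, `D = w²+2w+(1-v)²`). [folklore] -/
theorem mellin_left_apply (c d : ℚ) (z : Fin 2 → ℝ) :
    KZ.mellinIntegrand (![(1 + X 0 - X 1) * (X 1 * (1 - X 1) - X 0 * (1 + X 0)),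
        4 * X 0 * X 1 * ((1 - X 1) ^ 2 + X 0 * (2 + X 0 - X 1)),
        (X 0 ^ 2 + 2 * X 0 + (1 - X 1) ^ 2) * (X 1 + X 0)] : Fin 3 → MvPolynomial (Fin 2) ℚ)
        ![c - 1 / 2 - d, d - 1, 1] 4 z =
      4 * (((1 + z 0 - z 1) * (z 1 * (1 - z 1) - z 0 * (1 + z 0))) ^ ((c:ℝ) - 1 / 2 - d) *
        (4 * z 0 * z 1 * ((1 - z 1) ^ 2 + z 0 * (2 + z 0 - z 1))) ^ ((d:ℝ) - 1) *
        ((z 0 ^ 2 + 2 * z 0 + (1 - z 1) ^ 2) * (z 1 + z 0))) := by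
  rw [KZ.mellinIntegrand_apply, Fin.prod_univ_three]
  simp only [Matrix.cons_val_zero, Matrix.cons_val_one, Matrix.cons_val, map_sub, map_mul, map_add, map_pow,
    map_one, map_ofNat, MvPolynomial.aeval_X]
  push_cast
  rw [Real.rpow_one]

/-! ## The three pull-back identities -/

/-- Pull-back of the simplex integrand along the linear Dirichlet chart `(t,u) ↦ (u,(1-u)t)`:
`ℓ₂(u,(1-u)t)·(1-u) = 2 u^{c-½-d} (1-u)^{2c+2d-1} t^{2c-1} (1-t²)^{d-1}`. [folklore] -/
theorem left_pullback_linear (c d : ℝ) {t u : ℝ} (ht : 0 < t) (ht1 : t < 1) (hu1 : u < 1) :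
    2 * (u ^ (c - 1 / 2 - d) * (1 - u) * ((1 - u) * t) ^ (2 * c - 1) *
        ((1 - u) ^ 2 - ((1 - u) * t) ^ 2) ^ (d - 1)) * (1 - u) =
      2 * u ^ (c - 1 / 2 - d) * (1 - u) ^ (2 * c + 2 * d - 1) * t ^ (2 * c - 1) * (1 - t ^ 2) ^ (d - 1) := by
  have h1u : 0 < 1 - u := by linarith
  have h1t : 0 ≤ 1 - t ^ 2 := by nlinarith
  have e : (1 - u) ^ 2 - ((1 - u) * t) ^ 2 = (1 - u) ^ 2 * (1 - t ^ 2) := by ring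
  have hu' : (1 - u) ^ (2 * c + 2 * d - 1) =
      (1 - u) * (1 - u) ^ (2 * c - 1) * ((1 - u) ^ 2) ^ (d - 1) * (1 - u) := by
    rw [show (2 * c + 2 * d - 1 : ℝ) = 1 + (2 * c - 1) + 2 * (d - 1) + 1 by ring, Real.rpow_add h1u,
      Real.rpow_add h1u, Real.rpow_add h1u, Real.rpow_one, Real.rpow_mul h1u.le, Real.rpow_two]
  rw [e, Real.mul_rpow h1u.le ht.le, Real.mul_rpow (sq_nonneg _) h1t, hu']
  ring

/-- Pull-back of the lens integrand along the chart `χ(x,σ) = (σ,xσ)`: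
`ℓ₃(σ,xσ)·σ = 2 x^{c-½-d} (1-x) σ^{2c-1} ((1-x)²-σ²)^{d-1}`. [folklore] -/
theorem left_pullback_chi (c d : ℝ) {x σ : ℝ} (hx : 0 < x) (hσ : 0 < σ) (hxσ : x + σ < 1) :
    2 * ((x * σ * σ) ^ (c - 1 / 2 - d) * (σ - x * σ) * ((σ - x * σ) ^ 2 - σ ^ 4) ^ (d - 1)) * σ =
      2 * (x ^ (c - 1 / 2 - d) * (1 - x) * σ ^ (2 * c - 1) * ((1 - x) ^ 2 - σ ^ 2) ^ (d - 1)) := by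
  have h1 : 0 ≤ (1 - x) ^ 2 - σ ^ 2 := by nlinarith
  have e1 : x * σ * σ = x * σ ^ 2 := by ring
  have e2 : (σ - x * σ) ^ 2 - σ ^ 4 = σ ^ 2 * ((1 - x) ^ 2 - σ ^ 2) := by ring
  have e3 : σ - x * σ = σ * (1 - x) := by ring
  have hσ' : σ ^ (2 * c - 1) = (σ ^ 2) ^ (c - 1 / 2 - d) * (σ ^ 2) ^ (d - 1) * σ * σ := by
    rw [← Real.rpow_two, ← Real.rpow_mul hσ.le, ← Real.rpow_mul hσ.le, ← Real.rpow_add hσ,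
      ← Real.rpow_add_one hσ.ne', ← Real.rpow_add_one hσ.ne']
    congr 1
    ring
  rw [e1, e2, e3, Real.mul_rpow hx.le (sq_nonneg σ), Real.mul_rpow (sq_nonneg σ) h1, hσ']
  ring

/-- Pull-back of the lens integrand along the chart `(w,v) ↦ (1+w-v, v(1-v)-w(1+w))`, times the Jacobian `2(v+w)`:
the left integrand `4 F^{c-½-d} X^{d-1} D (v+w)` of `P` (three polynomial identities). [folklore] -/
theorem left_pullback_PT (A B : ℝ) (w v : ℝ) :
    2 * (((v * (1 - v) - w * (1 + w)) * (1 + w - v)) ^ A * ((1 + w - v) - (v * (1 - v) - w * (1 + w))) *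
        (((1 + w - v) - (v * (1 - v) - w * (1 + w))) ^ 2 - (1 + w - v) ^ 4) ^ B) * (2 * (v + w)) =
      4 * (((1 + w - v) * (v * (1 - v) - w * (1 + w))) ^ A *
        (4 * w * v * ((1 - v) ^ 2 + w * (2 + w - v))) ^ B * ((w ^ 2 + 2 * w + (1 - v) ^ 2) * (v + w))) := by
  have e1 : (v * (1 - v) - w * (1 + w)) * (1 + w - v) = (1 + w - v) * (v * (1 - v) - w * (1 + w)) := by ring
  have e2 : ((1 + w - v) - (v * (1 - v) - w * (1 + w))) ^ 2 - (1 + w - v) ^ 4 =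
      4 * w * v * ((1 - v) ^ 2 + w * (2 + w - v)) := by ring
  rw [e1, e2]
  ring

/-! ## The left chain -/

/-- **The left chain of the two-duplication move**: the unweighted left box
`U = [(0,1)², x^{c-½-d}(1-x)^{2c+2d-1} y^{c-1}(1-y)^{d-1}]` (a box-Mellin member) is equivalent to a representation
`L` pinned on the parameter surface `P = {0 < w, w(1+w) < v(1-v)}` with the left integrand `4 F^{c-½-d} X^{d-1} D (v+w)`,
WHICH EXISTS — Kummer covering `y = η²`, coordinate swap, linear Dirichlet chart onto the simplex, the chart `χ` onto
the lens, and the chart `(σ,g)` of the lens by `P` (rule (2) five times). [cite: KontsevichZagier2001, §1.2 rule (2)] -/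
theorem left_chain : ∀ (c d : ℚ) (U : Literature.NumberTheory.Transcendental.KZ.IntegralRep 2), Literature.NumberTheory.Transcendental.KZ.IsMellinMemberWith (![MvPolynomial.X 0, 1 - MvPolynomial.X 0, MvPolynomial.X 1, 1 - MvPolynomial.X 1] : Fin 4 → MvPolynomial (Fin 2) ℚ) ![c - 1 / 2 - d, 2 * c + 2 * d - 1, c - 1, d - 1] 1 U → ∃ L : Literature.NumberTheory.Transcendental.KZ.IntegralRep 2, L.domain = {z : Fin 2 → ℝ | 0 < z 0 ∧ z 0 * (1 + z 0) < z 1 * (1 - z 1)} ∧ Set.EqOn L.integrand (Literature.NumberTheory.Transcendental.KZ.mellinIntegrand (![(1 + MvPolynomial.X 0 - MvPolynomial.X 1) * (MvPolynomial.X 1 * (1 - MvPolynomial.X 1) - MvPolynomial.X 0 * (1 + MvPolynomial.X 0)), 4 * MvPolynomial.X 0 * MvPolynomial.X 1 * ((1 - MvPolynomial.X 1) ^ 2 + MvPolynomial.X 0 * (2 + MvPolynomial.X 0 - MvPolynomial.X 1)), (MvPolynomial.X 0 ^ 2 + 2 * MvPolynomial.X 0 + (1 - MvPolynomial.X 1)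 ^ 2) * (MvPolynomial.X 1 + MvPolynomial.X 0)] : Fin 3 → MvPolynomial (Fin 2) ℚ) ![c - 1 / 2 - d, d - 1, 1] 4) L.domain ∧ Literature.NumberTheory.Transcendental.KZ.Equivalent U L := by
  intro c d U hU
  have hne01 : (0 : Fin 2) ≠ 1 := by decide
  -- (1) the Kummer covering `y = η²`
  obtain ⟨u₁, h₁⟩ := (KZ.exists_isMellinMemberWith_iff _ _ _).2 (hU.integrableOn_dilate (j := (1 : Fin 2)) (k := 1))
  have e₁ : KZ.Equivalent u₁ U := h₁.of_sub_of_mem_relations_dilate hU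
  have hu₁d : u₁.domain = {z | ∀ i, z i ∈ Set.Ioo (0:ℝ) 1} := by
    rw [h₁.1, KZ.mellinBox_dilateData, KZ.mellinBox_dilateFamily, QuadStep.mellinBox_betaBox]
    ext z
    simp only [mem_inter_iff, mem_preimage, mem_setOf_eq]
    exact ⟨fun h => h.1, fun h => ⟨h, KZ.boxDilation_mem_box h⟩⟩
  have hu₁i : ∀ z ∈ u₁.domain, u₁.integrand z = 2 * (z 0) ^ ((c:ℝ) - 1 / 2 - d) *
      (1 - z 0) ^ (2 * (c:ℝ) + 2 * d - 1) * (z 1) ^ (2 * (c:ℝ) - 1) * (1 - z 1 ^ 2) ^ ((d:ℝ) - 1) := by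
    intro z hz
    have hzb : ∀ i, z i ∈ Set.Ioo (0:ℝ) 1 := by rw [hu₁d] at hz; exact hz
    rw [h₁.2 hz, KZ.mellinIntegrand_dilateData, QuadStep.mellin_betaBox_apply]
    simp only [KZ.boxDilation_apply_self, KZ.boxDilation_apply_of_ne _ hne01, Nat.reduceAdd, pow_one,
      Matrix.cons_val_zero, Matrix.cons_val_one, Matrix.cons_val]
    push_cast
    have key := QuadStep.sq_rpow_mul_self (hzb 1).1 ((c:ℝ) - 1)
    rw [show 2 * ((c:ℝ) - 1) + 1 = 2 * (c:ℝ) - 1 by ring] at key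
    linear_combination (2 * (z 0) ^ ((c:ℝ) - 1 / 2 - d) * (1 - z 0) ^ (2 * (c:ℝ) + 2 * d - 1) *
      (1 - z 1 ^ 2) ^ ((d:ℝ) - 1)) * key
  -- (2a) the coordinate swap
  set u₂ : KZ.IntegralRep 2 := u₁.reindex (Equiv.swap (0 : Fin 2) 1) with hu₂
  have e₂ : KZ.Equivalent u₁ u₂ := KZ.of_sub_of_reindex_mem_relations u₁ _
  have hu₂d : u₂.domain = {z : Fin 2 → ℝ | z 0 ∈ Set.Ioo (0:ℝ) 1 ∧ z 1 ∈ Set.Ioo (0:ℝ) 1} := by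
    ext z
    simp only [hu₂, KZ.IntegralRep.reindex_domain, hu₁d, mem_setOf_eq, Fin.forall_fin_two,
      Equiv.swap_apply_left, Equiv.swap_apply_right]
    exact and_comm
  have hu₂i : ∀ z ∈ {z : Fin 2 → ℝ | z 0 ∈ Set.Ioo (0:ℝ) 1 ∧ z 1 ∈ Set.Ioo (0:ℝ) 1},
      u₂.integrand z = 2 * (z 1) ^ ((c:ℝ) - 1 / 2 - d) * (1 - z 1) ^ (2 * (c:ℝ) + 2 * d - 1) *
        (z 0) ^ (2 * (c:ℝ) - 1) * (1 - z 0 ^ 2) ^ ((d:ℝ) - 1) := by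
    intro z hz
    have hz' : (fun i => z (Equiv.swap (0 : Fin 2) 1 i)) ∈ u₁.domain := by
      rw [hu₁d]
      exact Fin.forall_fin_two.2 ⟨by simpa using hz.2, by simpa using hz.1⟩
    rw [hu₂, KZ.IntegralRep.reindex_integrand]
    simp only
    rw [hu₁i _ hz']
    simp only [Equiv.swap_apply_left, Equiv.swap_apply_right]
  -- (2b) the linear Dirichlet chart onto the simplex representation `S`, which exists
  obtain ⟨Ψ, Ψ', hΨ0, hΨ1, hsaΨ, hderivΨ, hinjΨ, himageΨ, hdetΨ⟩ := KZ.exists_dirichletLinearChart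
  have hpullΨ : ∀ z ∈ {z : Fin 2 → ℝ | z 0 ∈ Set.Ioo (0:ℝ) 1 ∧ z 1 ∈ Set.Ioo (0:ℝ) 1},
      u₂.integrand z = KZ.mellinIntegrand (![X 0, 1 - X 0, X 1, (1 - X 0) ^ 2 - X 1 ^ 2] :
        Fin 4 → MvPolynomial (Fin 2) ℚ) ![c - 1 / 2 - d, 1, 2 * c - 1, d - 1] 2 (Ψ z) * |(Ψ' z).det| := by
    intro z hz
    rw [hu₂i z hz, hdetΨ z hz, mellin_simplexL_apply, hΨ0, hΨ1]
    exact (left_pullback_linear _ _ hz.1.1 hz.1.2 hz.2.2).symm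
  have hposS : ∀ w ∈ {z : Fin 2 → ℝ | 0 < z 0 ∧ 0 < z 1 ∧ z 0 + z 1 < 1}, ∀ k, 0 < aeval w
      ((![X 0, 1 - X 0, X 1, (1 - X 0) ^ 2 - X 1 ^ 2] : Fin 4 → MvPolynomial (Fin 2) ℚ) k) := by
    rintro w ⟨h0, h1, h2⟩ k
    fin_cases k
    · simpa using h0
    · simpa [sub_pos] using (by linarith : w 0 < 1)
    · simpa using h1
    · have e : (1 - w 0) ^ 2 - w 1 ^ 2 = (1 - w 0 - w 1) * (1 - w 0 + w 1) := by ring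
      simpa [e] using mul_pos (by linarith : 0 < 1 - w 0 - w 1) (by linarith : 0 < 1 - w 0 + w 1)
  have hintS : IntegrableOn (KZ.mellinIntegrand (![X 0, 1 - X 0, X 1, (1 - X 0) ^ 2 - X 1 ^ 2] :
      Fin 4 → MvPolynomial (Fin 2) ℚ) ![c - 1 / 2 - d, 1, 2 * c - 1, d - 1] 2)
      {z : Fin 2 → ℝ | 0 < z 0 ∧ 0 < z 1 ∧ z 0 + z 1 < 1} := by
    rw [← himageΨ, integrableOn_image_iff_integrableOn_abs_det_fderiv_smul volume KZ.measurableSet_box2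
      (fun z _ => (hderivΨ z).hasFDerivWithinAt) hinjΨ]
    have h1 : IntegrableOn u₂.integrand {z : Fin 2 → ℝ | z 0 ∈ Set.Ioo (0:ℝ) 1 ∧ z 1 ∈ Set.Ioo (0:ℝ) 1} :=
      hu₂d ▸ u₂.integrableOn
    refine h1.congr_fun (fun z hz => ?_) KZ.measurableSet_box2
    rw [hpullΨ z hz, smul_eq_mul, mul_comm]
  let S : KZ.IntegralRep 2 := ⟨{z : Fin 2 → ℝ | 0 < z 0 ∧ 0 < z 1 ∧ z 0 + z 1 < 1}, _,
    KZ.isSemialgebraic_simplex2, KZ.isSemialgebraicFunOn_mellinIntegrand KZ.isSemialgebraic_simplex2 _ _ 2 hposS,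
    hintS⟩
  have relΨ : of u₂ - of S ∈ relations :=
    changeOfVariablesRel_subset_relations ⟨2, u₂, S, Ψ, Ψ', by rw [hu₂d]; exact hsaΨ,
      fun z _ => (hderivΨ z).hasFDerivWithinAt, by rw [hu₂d]; exact hinjΨ, by rw [hu₂d]; exact himageΨ.symm,
      fun z hz => hpullΨ z (by rw [hu₂d] at hz; exact hz), rfl⟩
  -- (3) the chart `χ` onto the lens representation `T`, which exists
  obtain ⟨χ, χ', hχ0, hχ1, hsaχ, hderivχ, hinjχ, himageχ, hdetχ⟩ := exists_chartChi
  have hpullχ : ∀ z ∈ {z : Fin 2 → ℝ | 0 < z 0 ∧ 0 < z 1 ∧ z 0 + z 1 < 1},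
      S.integrand z = KZ.mellinIntegrand (![X 1 * X 0, X 0 - X 1, (X 0 - X 1) ^ 2 - X 0 ^ 4] :
        Fin 3 → MvPolynomial (Fin 2) ℚ) ![c - 1 / 2 - d, 1, d - 1] 2 (χ z) * |(χ' z).det| := by
    rintro z ⟨h0, h1, h2⟩
    rw [hdetχ z ⟨h0, h1, h2⟩, mellin_lens_apply, hχ0, hχ1]
    change KZ.mellinIntegrand _ _ _ z = _
    rw [mellin_simplexL_apply]
    exact (left_pullback_chi _ _ h0 h1 h2).symm
  have hposT : ∀ y ∈ {z : Fin 2 → ℝ | 0 < z 1 ∧ z 1 < z 0 * (1 - z 0)}, ∀ k, 0 < aeval y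
      ((![X 1 * X 0, X 0 - X 1, (X 0 - X 1) ^ 2 - X 0 ^ 4] : Fin 3 → MvPolynomial (Fin 2) ℚ) k) := by
    rintro y ⟨h1, h2⟩ k
    have hy0 : 0 < y 0 := by nlinarith [sq_nonneg (y 0)]
    have hy0' : y 0 < 1 := by nlinarith
    fin_cases k
    · simpa using mul_pos h1 hy0
    · simp only [Fin.reduceFinMk, Matrix.cons_val_one, Matrix.cons_val_zero, map_sub, MvPolynomial.aeval_X, sub_pos]
      nlinarith
    · have e : (y 0 - y 1) ^ 2 - y 0 ^ 4 = (y 0 - y 1 - y 0 ^ 2) * (y 0 - y 1 + y 0 ^ 2) := by ring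
      have : 0 < (y 0 - y 1 - y 0 ^ 2) * (y 0 - y 1 + y 0 ^ 2) := mul_pos (by nlinarith) (by nlinarith)
      simpa [e] using this
  have hintT : IntegrableOn (KZ.mellinIntegrand (![X 1 * X 0, X 0 - X 1, (X 0 - X 1) ^ 2 - X 0 ^ 4] :
      Fin 3 → MvPolynomial (Fin 2) ℚ) ![c - 1 / 2 - d, 1, d - 1] 2)
      {z : Fin 2 → ℝ | 0 < z 1 ∧ z 1 < z 0 * (1 - z 0)} := by
    rw [← himageχ, integrableOn_image_iff_integrableOn_abs_det_fderiv_smul volume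
      (KZ.isSemialgebraic_simplex2.measurableSet_holds) (fun z _ => (hderivχ z).hasFDerivWithinAt) hinjχ]
    refine S.integrableOn.congr_fun (fun z hz => ?_) KZ.isSemialgebraic_simplex2.measurableSet_holds
    rw [hpullχ z hz, smul_eq_mul, mul_comm]
  let T : KZ.IntegralRep 2 := ⟨{z : Fin 2 → ℝ | 0 < z 1 ∧ z 1 < z 0 * (1 - z 0)}, _,
    isSemialgebraic_lens, KZ.isSemialgebraicFunOn_mellinIntegrand isSemialgebraic_lens _ _ 2 hposT, hintT⟩
  have relχ : of S - of T ∈ relations :=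
    changeOfVariablesRel_subset_relations ⟨2, S, T, χ, χ', hsaχ, fun z _ => (hderivχ z).hasFDerivWithinAt,
      hinjχ, himageχ.symm, fun z hz => hpullχ z hz, rfl⟩
  -- (4) the chart of the lens by the parameter surface: the representation `L` on `P`, which exists
  obtain ⟨Φ, Φ', hΦ0, hΦ1, hsaΦ, hderivΦ, hinjΦ, himageΦ, hdetΦ⟩ := exists_chartPT
  have hpullΦ : ∀ z ∈ {z : Fin 2 → ℝ | 0 < z 0 ∧ z 0 * (1 + z 0) < z 1 * (1 - z 1)},
      KZ.mellinIntegrand (![(1 + X 0 - X 1) * (X 1 * (1 - X 1) - X 0 * (1 + X 0)),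
          4 * X 0 * X 1 * ((1 - X 1) ^ 2 + X 0 * (2 + X 0 - X 1)),
          (X 0 ^ 2 + 2 * X 0 + (1 - X 1) ^ 2) * (X 1 + X 0)] : Fin 3 → MvPolynomial (Fin 2) ℚ)
        ![c - 1 / 2 - d, d - 1, 1] 4 z = T.integrand (Φ z) * |(Φ' z).det| := by
    intro z hz
    rw [hdetΦ z hz, mellin_left_apply]
    change _ = KZ.mellinIntegrand _ _ _ (Φ z) * _
    rw [mellin_lens_apply, hΦ0, hΦ1]
    exact (left_pullback_PT _ _ (z 0) (z 1)).symm
  have hposP : ∀ z ∈ {z : Fin 2 → ℝ | 0 < z 0 ∧ z 0 * (1 + z 0) < z 1 * (1 - z 1)}, ∀ k, 0 < aeval z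
      ((![(1 + X 0 - X 1) * (X 1 * (1 - X 1) - X 0 * (1 + X 0)),
          4 * X 0 * X 1 * ((1 - X 1) ^ 2 + X 0 * (2 + X 0 - X 1)),
          (X 0 ^ 2 + 2 * X 0 + (1 - X 1) ^ 2) * (X 1 + X 0)] : Fin 3 → MvPolynomial (Fin 2) ℚ) k) := by
    intro z hz k
    obtain ⟨hz1, hz1', hwv⟩ := regionP_bounds hz
    have hw := hz.1
    fin_cases k
    · simpa using mul_pos (by linarith : 0 < 1 + z 0 - z 1) (sub_pos.2 hz.2)
    · simp only [Fin.reduceFinMk, Matrix.cons_val_one, Matrix.cons_val_zero, map_sub, map_mul, map_add, map_pow,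
        map_one, map_ofNat, MvPolynomial.aeval_X]
      have : 0 < (1 - z 1) ^ 2 + z 0 * (2 + z 0 - z 1) := by nlinarith [pow_pos (sub_pos.2 hz1') 2]
      positivity
    · simp only [Fin.reduceFinMk, Matrix.cons_val, map_sub, map_mul, map_add, map_pow, map_one, map_ofNat,
        MvPolynomial.aeval_X]
      have : 0 < z 0 ^ 2 + 2 * z 0 + (1 - z 1) ^ 2 := by positivity
      positivity
  have hintP : IntegrableOn (KZ.mellinIntegrand (![(1 + X 0 - X 1) * (X 1 * (1 - X 1) - X 0 * (1 + X 0)),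
      4 * X 0 * X 1 * ((1 - X 1) ^ 2 + X 0 * (2 + X 0 - X 1)),
      (X 0 ^ 2 + 2 * X 0 + (1 - X 1) ^ 2) * (X 1 + X 0)] : Fin 3 → MvPolynomial (Fin 2) ℚ)
        ![c - 1 / 2 - d, d - 1, 1] 4) {z : Fin 2 → ℝ | 0 < z 0 ∧ z 0 * (1 + z 0) < z 1 * (1 - z 1)} := by
    have key := (integrableOn_image_iff_integrableOn_abs_det_fderiv_smul volume
      isSemialgebraic_regionP.measurableSet_holds (fun z _ => (hderivΦ z).hasFDerivWithinAt) hinjΦ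
      T.integrand).1 (by rw [himageΦ]; exact T.integrableOn)
    refine key.congr_fun (fun z hz => ?_) isSemialgebraic_regionP.measurableSet_holds
    change |(Φ' z).det| • T.integrand (Φ z) = _
    rw [hpullΦ z hz, smul_eq_mul, mul_comm]
  let L : KZ.IntegralRep 2 := ⟨{z : Fin 2 → ℝ | 0 < z 0 ∧ z 0 * (1 + z 0) < z 1 * (1 - z 1)}, _,
    isSemialgebraic_regionP, KZ.isSemialgebraicFunOn_mellinIntegrand isSemialgebraic_regionP _ _ 4 hposP, hintP⟩
  have relΦ : of L - of T ∈ relations :=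
    changeOfVariablesRel_subset_relations ⟨2, L, T, Φ, Φ', hsaΦ, fun z _ => (hderivΦ z).hasFDerivWithinAt,
      hinjΦ, himageΦ.symm, fun z hz => hpullΦ z hz, rfl⟩
  refine ⟨L, rfl, fun z _ => rfl, ?_⟩
  have e : of U - of L = -(of u₁ - of U) + (of u₁ - of u₂) + (of u₂ - of S) + (of S - of T) - (of L - of T) := by
    abel
  show of U - of L ∈ relations
  rw [e]
  exact relations.sub_mem (relations.add_mem (relations.add_mem (relations.add_mem (relations.neg_mem e₁) e₂)
    relΨ) relχ) relΦ

end DdStep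

end Summit.KontsevichZagierPeriods.FermatIsogeny.BetaProductSectorStubs

end
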